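import Mathlib
import Literature.LinearAlgebra.Matrix.OstrowskiComparisonMatrix
import Literature.LinearAlgebra.Matrix.ZMatrixSupersolution
import Literature.Analysis.Convex.LinearProgrammingDuality
import HarnessLib

/-!
# Factor width two = scaled diagonal dominance = symmetric `H₊` (Boman–Chen–Parekh–Toledo 2005),
# and the cones `DD_n ⊆ SDD_n ⊆ PSD_n` behind DSOS/SDSOS optimisation (Ahmadi–Majumdar 2019)

Topic `Literature/LinearAlgebra/Matrix`, namespace `Literature.LinearAlgebra.Matrix`; real symmetric
matrices indexed by a `Fintype`.  Continues `OstrowskiComparisonMatrix.lean` (the comparison matrix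
`𝓜(A)` = `comparisonMatrix A`, a Z-matrix) and `ZMatrixSupersolution.lean` (a symmetric Z-matrix with a
positive supersolution is positive semidefinite), and uses Farkas' lemma in the form
`Literature.Analysis.Convex.LPDuality.farkas_nonneg_le` [Schrijver1986, Cor 7.1f].

Sources, read page by page (`lit read doi:10.1016/j.laa.2005.03.029`, author version, 13 PDF pages —
page numbers below are its PDF pages; `lit read arxiv:1706.02586`):

* [BomanEtAl2005] E. G. Boman, D. Chen, O. Parekh, S. Toledo, *On factor width and symmetric
  H-matrices*, Linear Algebra Appl. 405 (2005) 239–248.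
  - Definition 1 (p. 3): "The factor width of a real symmetric matrix `A` is the smallest integer `k`
    such that there exists a real (rectangular) matrix `V` where `A = V Vᵀ` and each column of `V`
    contains at most `k` non-zeros."  Here only the class `FW(2)`: `HasFactorWidthTwo`.
  - Proposition 2 (p. 4): "If `A` is SPSD and diagonally dominant then `A` has factor width at most
    two", with the printed decomposition
    `A = Σ_i (a_ii − Σ_{j≠i} |a_ij|) e_i e_iᵀ + Σ_{a_ij>0} a_ij (e_i+e_j)(e_i+e_j)ᵀ + Σ_{a_ij<0} (−a_ij)(e_i−e_j)(e_i−e_j)ᵀ`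
    (`IsDiagDominant.hasFactorWidthTwo`; "diagonally dominant" is taken with the non-negative
    diagonal built in, `Σ_{j≠i} |a_ij| ≤ a_ii`, as in [AhmadiMajumdar2019, §3.1 Definition 3]).
  - Definition 7 (p. 5): "`A` is generalized (weakly) diagonally dominant if there exists a positive
    vector `y > 0` such that for every row `i`, `|a_ii| y_i ≥ Σ_{j≠i} |a_ij| y_j`" … "equivalent to
    the problem of finding a positive diagonal matrix `D` such that `AD` (or equivalently, `DAD`) is
    diagonally dominant" (`IsScaledDiagDominant`, `isScaledDiagDominant_iff_exists_diagonal`).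
  - Lemma 5 / Definition 6 (p. 5): a symmetric matrix is an M-matrix iff it is a Z-matrix and positive
    semidefinite; `A` is an H-matrix iff `𝓜(A)` is an M-matrix; `H₊` = H-matrices with non-negative
    diagonal.  Accordingly "symmetric `H₊`" is rendered here as
    `A.IsSymm ∧ (∀ i, 0 ≤ A i i) ∧ (comparisonMatrix A).PosSemidef`.
  - Theorem 8 (p. 6): "A symmetric matrix `A` is an H-matrix if and only if `A` is generalized (weakly)
    diagonally dominant" (`isScaledDiagDominant_iff_posSemidef_comparisonMatrix`), via Lemma 18 and
    Lemma 20 (Appendix, pp. 12–13): "For any symmetric positive semidefinite matrix `M` there exists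
    a vector `y > 0` such that `M y ≥ 0`", proved there — and here — by Farkas' lemma
    (`exists_pos_mulVec_nonneg_of_posSemidef`).
  - Theorem 9 (p. 6): "A matrix has factor width at most two if and only if it is a symmetric
    `H₊`-matrix" (`hasFactorWidthTwo_iff_posSemidef_comparisonMatrix`,
    `hasFactorWidthTwo_iff_isScaledDiagDominant`; the two directions are
    `IsScaledDiagDominant.hasFactorWidthTwo` and `HasFactorWidthTwo.posSemidef_comparisonMatrix`).
    Theorem 16 (p. 10): "Matrix `A` has factor-width at most 2 if and only if it is symmetric with
    non-negative diagonals, and satisfies `‖d_n(|A|)‖ ≤ 2`", whose proof (p. 11) reads the norm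
    condition as "`2D_A − |A|` is positive semidefinite. `2D_A − |A|` is exactly `A`'s comparison
    matrix" — the form typed here (the scaled two-norm `‖d_n(·)‖` of §4 and the lower bound of
    Theorem 15 are not formalised).
  - Proposition 3 (p. 4) with `k = 3`: `v vᵀ` for `v = (1,1,1)` has factor width `3`
    (`not_hasFactorWidthTwo_ones_fin_three`: `FW(2) ⊊ PSD` from `n = 3` on, cf.
    [AhmadiMajumdar2019, §3.1] "These containments are strict for `n > 2`").
* [AhmadiMajumdar2019] A. A. Ahmadi, A. Majumdar, *DSOS and SDSOS optimization: more tractable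
  alternatives to sum of squares and semidefinite optimization*, SIAM J. Appl. Algebra Geom. 3 (2019)
  193–230 (arXiv:1706.02586), §3.1 — numbered below as in the held arXiv text
  (`paper:arxiv-1706.02586`, whose environments are numbered per kind): Definition 3 "A symmetric
  matrix `A` is diagonally dominant (dd) if `a_ii ≥ Σ_{j≠i} |a_ij|` for all `i`. A symmetric matrix `A`
  is scaled diagonally dominant (sdd) if there exists a diagonal matrix `D`, with positive diagonal
  entries, such that `DAD` is dd"; "`DD_n ⊆ SDD_n ⊆ P_n`. These containments are strict for `n > 2`"
  (`IsDiagDominant.isScaledDiagDominant`, `IsScaledDiagDominant.posSemidef`,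
  `IsDiagDominant.posSemidef`, `not_hasFactorWidthTwo_ones_fin_three`); Lemma 1 (Barker and Carlson:
  dd ⇔ non-negative combination of `v vᵀ`, `v` with at most two non-zero entries `±1`; the direction ⇒
  is Proposition 2 below); Theorem 4 "A symmetric matrix `Q` is sdd if and only if it has 'factor
  width' at most 2" ("see theorems 8 and 9 by Boman et al."); Lemma 2 "`Q` is sdd if and only if
  `Q = Σ_{i<j} M^{ij}`, where each `M^{ij}` is … zero except for four entries `(M^{ij})_ii, (M^{ij})_ij,
  (M^{ij})_ji, (M^{ij})_jj`, which make the `2 × 2` matrix … positive semidefinite" — the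
  second-order-cone description of `SDD_n` (`HasFactorWidthTwo.of_sum_blocks`,
  `HasFactorWidthTwo.exists_sum_blocks`, `hasFactorWidthTwo_of_posSemidef_pair`; the direction ⇐ here
  via an explicit sdd scaling of a `2 × 2`-supported psd matrix and Theorem 9, instead of the source's
  `2 × 2` factorization `M^{ij} = w₁w₁ᵀ + w₂w₂ᵀ`).  These are the facts that make a rational dd Gram
  matrix, or a Gram matrix written as a sum of `2 × 2` psd blocks, an exact positivity certificate
  (the LP and SOCP inner approximations `DSOS ⊆ SDSOS ⊆ SOS`, Theorems 2, 3, 5 there).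

On the proof of Theorem 9 (⇒).  The source flips the sign of one entry in each two-entry column of
`V` to factor `𝓜(A)`; when several columns of `V` share a support pair this only produces a positive
semidefinite Z-matrix `B` with `B ≤ 𝓜(A)` entrywise and equal diagonal, which suffices because the
quadratic form of a Z-matrix does not decrease under `x ↦ |x|`
(the private lemma `IsZMatrix.posSemidef_of_posSemidef_le`).  The width-two factor of `B` used here is, column by
column, `2·diag(v∘v) − |v| |v|ᵀ ⪰ 0` for a column `v` with at most two non-zero entries
(Cauchy–Schwarz on a two-element support).

Not here: factor widths `k ≥ 3` and the bounds of §4; the polynomial cones `DSOS`/`SDSOS`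
themselves (Gram-matrix bookkeeping lives in `Literature.Computation.Certificates.GramSOS`; the
checker-side dd predicate over `ℚ` is `Literature.Computation.Certificates.PSD.IsDiagDominant`, and
`dd ⇒ psd` over `ℝ` in the `offRowSum` spelling is
`Literature.Analysis.ValidatedNumerics.IntervalGershgorin.posSemidef_of_diagDominant`; the STRICT
scaled-dominance margin `𝓜(A) u ≥ δ > 0` and its `‖A⁻¹‖` bounds are `…Matrix.VarahScaledBound`); the
`r-DSOS` hierarchy and its Pólya-type completeness.
-/

noncomputable section

namespace Literature.LinearAlgebra.Matrix

open scoped _root_.Matrix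
open Finset _root_.Matrix

variable {n : Type*} [Fintype n]

/-! ### Factor width two (Definition 1) -/

/-- **Factor width at most two**: `A = V Vᵀ` for a real `n × k` matrix `V` each of whose columns has
at most two non-zero entries. [cite: BomanEtAl2005, Definition 1] -/
def HasFactorWidthTwo (A : Matrix n n ℝ) : Prop :=
  ∃ (k : ℕ) (V : Matrix n (Fin k) ℝ), A = V * Vᵀ ∧ ∀ t, (univ.filter fun i => V i t ≠ 0).card ≤ 2

/-- A width-two factorization `A = V Vᵀ` is a sum of dyads `Σ_t v_t v_tᵀ` over the columns `v_t` of
`V`, each with at most two non-zero entries. [cite: BomanEtAl2005, Definition 1] -/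
theorem HasFactorWidthTwo.exists_dyads {A : Matrix n n ℝ} (h : HasFactorWidthTwo A) :
    ∃ (k : ℕ) (v : Fin k → n → ℝ), (∀ t, (univ.filter fun i => v t i ≠ 0).card ≤ 2) ∧
      ∀ i j, A i j = ∑ t, v t i * v t j := by
  obtain ⟨k, V, rfl, hV⟩ := h
  exact ⟨k, fun t i => V i t, hV, fun i j => by simp [mul_apply]⟩

/-- Conversely a sum `A = Σ_t c_t v_t v_tᵀ` of non-negatively weighted dyads whose vectors have at
most two non-zero entries has factor width at most two (the columns of `V` are `√c_t · v_t`).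
[cite: BomanEtAl2005, Definition 1 and proof of Proposition 2 ("one can readily construct a V …")] -/
theorem HasFactorWidthTwo.of_sum_dyads {ι : Type*} [Fintype ι] {A : Matrix n n ℝ} (c : ι → ℝ)
    (v : ι → n → ℝ) (hc : ∀ t, 0 ≤ c t) (hv : ∀ t, (univ.filter fun i => v t i ≠ 0).card ≤ 2)
    (hA : ∀ i j, A i j = ∑ t, c t * (v t i * v t j)) : HasFactorWidthTwo A := by
  classical
  set e := Fintype.equivFin ι
  refine ⟨Fintype.card ι, Matrix.of fun i s => √(c (e.symm s)) * v (e.symm s) i, ?_, ?_⟩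
  · ext i j
    rw [hA, mul_apply]
    simp only [transpose_apply, of_apply]
    rw [e.symm.sum_comp (fun t => √(c t) * v t i * (√(c t) * v t j))]
    exact sum_congr rfl fun t _ => by rw [mul_mul_mul_comm, Real.mul_self_sqrt (hc t)]
  · intro s
    refine le_trans (card_le_card fun i hi => ?_) (hv (e.symm s))
    simp only [mem_filter, mem_univ, true_and, of_apply] at hi ⊢
    intro h0
    exact hi (by rw [h0, mul_zero])

/-- A matrix of factor width at most two is positive semidefinite (`V Vᵀ ⪰ 0`; "`FW(n)` is precisely
the cone of SPSD matrices"). [cite: BomanEtAl2005, §2 (p. 4, "FW(k) is a pointed convex cone")] -/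
theorem HasFactorWidthTwo.posSemidef {A : Matrix n n ℝ} (h : HasFactorWidthTwo A) :
    A.PosSemidef := by
  obtain ⟨k, V, rfl, -⟩ := h
  simpa [conjTranspose_eq_transpose_of_trivial] using posSemidef_self_mul_conjTranspose V

/-- A matrix of factor width at most two is symmetric. [cite: BomanEtAl2005, Definition 1] -/
theorem HasFactorWidthTwo.isSymm {A : Matrix n n ℝ} (h : HasFactorWidthTwo A) : A.IsSymm := by
  obtain ⟨k, V, rfl, -⟩ := h
  simp [Matrix.IsSymm, transpose_mul]

/-- `FW(2)` is closed under addition (juxtapose the two factors).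
[cite: BomanEtAl2005, §2 (p. 4, "FW(k) is a pointed convex cone")] -/
theorem HasFactorWidthTwo.add {A B : Matrix n n ℝ} (hA : HasFactorWidthTwo A)
    (hB : HasFactorWidthTwo B) : HasFactorWidthTwo (A + B) := by
  obtain ⟨k, v, hv, hAv⟩ := hA.exists_dyads
  obtain ⟨k', w, hw, hBw⟩ := hB.exists_dyads
  refine HasFactorWidthTwo.of_sum_dyads (ι := Fin k ⊕ Fin k') (fun _ => 1) (Sum.elim v w)
    (fun _ => zero_le_one) ?_ ?_
  · rintro (t | t)
    · simpa using hv t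
    · simpa using hw t
  · intro i j
    simp [Fintype.sum_sum_type, hAv i j, hBw i j]

/-- `FW(2)` contains `0`. [cite: BomanEtAl2005, §2 (p. 4, "FW(k) is a pointed convex cone")] -/
theorem HasFactorWidthTwo.zero : HasFactorWidthTwo (0 : Matrix n n ℝ) :=
  ⟨0, 0, by simp, fun t => t.elim0⟩

/-- `FW(2)` is closed under finite sums. [cite: BomanEtAl2005, §2 (p. 4, "FW(k) is a pointed convex cone")] -/
theorem HasFactorWidthTwo.sum {ι : Type*} {M : ι → Matrix n n ℝ} (s : Finset ι)
    (h : ∀ t ∈ s, HasFactorWidthTwo (M t)) : HasFactorWidthTwo (∑ t ∈ s, M t) := by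
  classical
  induction s using Finset.induction_on with
  | empty => simpa using HasFactorWidthTwo.zero
  | insert a s ha ih =>
    rw [sum_insert ha]
    exact (h a (mem_insert_self a s)).add (ih fun t ht => h t (mem_insert_of_mem ht))

/-! ### Lemma 20: a positive semidefinite matrix has a positive vector with `M y ≥ 0` (Farkas) -/

/-- Quadratic/bilinear form as a double sum (plumbing). -/
@[folklore] private theorem dotProduct_mulVec_eq_sum_sum (x y : n → ℝ) (M : Matrix n n ℝ) :
    x ⬝ᵥ (M *ᵥ y) = ∑ i, ∑ j, x i * (M i j * y j) := by
  simp only [dotProduct, mulVec, Finset.mul_sum]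

/-- **Boman–Chen–Parekh–Toledo, Lemma 20.** "For any symmetric positive semidefinite matrix `M`,
there exists a vector `y > 0` such that `M y ≥ 0`."  Proof as printed: by Farkas' lemma
([Schrijver1986, Cor 7.1f], `LPDuality.farkas_nonneg_le`) either `M y ≥ 0, y ≥ 𝟙` is feasible or some
`u ≥ 0`, `u ≠ 0` has `M u ≤ 0`, whence `uᵀ M u = 0`, `M u = 0`, contradicting `uᵀ 𝟙 > 0`.
[cite: BomanEtAl2005, Lemma 20 (Appendix)] -/
theorem exists_pos_mulVec_nonneg_of_posSemidef {M : Matrix n n ℝ} (hM : M.PosSemidef) :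
    ∃ y : n → ℝ, (∀ i, 0 < y i) ∧ ∀ i, 0 ≤ (M *ᵥ y) i := by
  have hT : Mᵀ = M := by
    have h := hM.1.eq
    rwa [conjTranspose_eq_transpose_of_trivial] at h
  have hfar := (Literature.Analysis.Convex.LPDuality.farkas_nonneg_le (-M) (M *ᵥ 1)).2 ?_
  · obtain ⟨z, hz0, hz⟩ := hfar
    refine ⟨1 + z, fun i => ?_, fun i => ?_⟩
    · have h0 : 0 ≤ z i := hz0 i
      simp only [Pi.add_apply, Pi.one_apply]
      linarith
    · have h1 : ((-M) *ᵥ z) i ≤ (M *ᵥ 1) i := hz i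
      rw [neg_mulVec, Pi.neg_apply] at h1
      rw [mulVec_add, Pi.add_apply]
      linarith
  · intro u hu huM
    have hMu : ∀ i, (M *ᵥ u) i ≤ 0 := fun i => by
      have h1 : (0 : n → ℝ) i ≤ (u ᵥ* (-M)) i := huM i
      rw [vecMul_neg, Pi.neg_apply, Pi.zero_apply, ← mulVec_transpose, hT] at h1
      linarith
    have hle : star u ⬝ᵥ (M *ᵥ u) ≤ 0 := by
      rw [star_trivial]
      exact sum_nonpos fun i _ => mul_nonpos_of_nonneg_of_nonpos (hu i) (hMu i)
    have h0 : M *ᵥ u = 0 :=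
      (hM.dotProduct_mulVec_zero_iff u).1 (le_antisymm hle (hM.dotProduct_mulVec_nonneg u))
    have h2 : u ⬝ᵥ (M *ᵥ 1) = 0 := by
      rw [dotProduct_mulVec, ← mulVec_transpose, hT, h0, zero_dotProduct]
    exact le_of_eq h2.symm

section DiagonalDominance

variable [DecidableEq n]

/-! ### Diagonal dominance and scaled diagonal dominance (Definition 7; Ahmadi–Majumdar §3.1) -/

/-- **Diagonally dominant** (dd) real matrix, with the non-negative diagonal built in:
`Σ_{j ≠ i} |a_ij| ≤ a_ii` for every row `i`.
[cite: AhmadiMajumdar2019, §3.1 Definition 3 (dd and sdd matrices)]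
[cite: BomanEtAl2005, §2 (p. 4, Proposition 2: "SPSD and diagonally dominant")] -/
def IsDiagDominant (A : Matrix n n ℝ) : Prop :=
  ∀ i, ∑ j ∈ univ.erase i, |A i j| ≤ A i i

/-- **Scaled diagonally dominant** (sdd) = generalized (weakly) diagonally dominant with
non-negative diagonal: some entrywise positive `y` has `Σ_{j ≠ i} |a_ij| y_j ≤ a_ii y_i` for every
row `i`. [cite: BomanEtAl2005, Definition 7]
[cite: AhmadiMajumdar2019, §3.1 Definition 3 (dd and sdd matrices)] -/
def IsScaledDiagDominant (A : Matrix n n ℝ) : Prop :=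
  ∃ y : n → ℝ, (∀ i, 0 < y i) ∧ ∀ i, ∑ j ∈ univ.erase i, |A i j| * y j ≤ A i i * y i

/-- A dd matrix has non-negative diagonal.
[cite: AhmadiMajumdar2019, §3.1 Definition 3 (dd and sdd matrices)] -/
theorem IsDiagDominant.diag_nonneg {A : Matrix n n ℝ} (h : IsDiagDominant A) (i : n) :
    0 ≤ A i i :=
  (sum_nonneg fun j _ => abs_nonneg (A i j)).trans (h i)

/-- An sdd matrix has non-negative diagonal (it lies in `H₊`).
[cite: BomanEtAl2005, Definition 7 and the class `H₊` (p. 5)] -/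
theorem IsScaledDiagDominant.diag_nonneg {A : Matrix n n ℝ} (h : IsScaledDiagDominant A) (i : n) :
    0 ≤ A i i := by
  obtain ⟨y, hy, h⟩ := h
  have h0 : 0 ≤ A i i * y i :=
    (sum_nonneg fun j _ => mul_nonneg (abs_nonneg _) (hy j).le).trans (h i)
  by_contra hlt
  have hlt' : A i i < 0 := lt_of_not_ge hlt
  nlinarith [hy i]

/-- `DD_n ⊆ SDD_n` (take `y = 𝟙`). [cite: AhmadiMajumdar2019, §3.1 after Definition 3 ("DD_n ⊆ SDD_n ⊆ P_n")] -/
theorem IsDiagDominant.isScaledDiagDominant {A : Matrix n n ℝ} (h : IsDiagDominant A) :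
    IsScaledDiagDominant A :=
  ⟨fun _ => 1, fun _ => one_pos, fun i => by simpa using h i⟩

/-- Entries of `D A D` for a diagonal `D = diag(d)`: `(DAD)_ij = d_i a_ij d_j` (plumbing). -/
@[folklore] private theorem diagonal_mul_mul_diagonal_apply (d : n → ℝ) (A : Matrix n n ℝ) (i j : n) :
    (diagonal d * A * diagonal d) i j = d i * A i j * d j := by
  rw [mul_diagonal, diagonal_mul]

/-- The remark after Definition 7 / Ahmadi–Majumdar's definition of sdd: `A` is generalized
diagonally dominant with non-negative diagonal iff `DAD` is dd for some positive diagonal `D`.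
[cite: BomanEtAl2005, Definition 7 (remark: "finding a positive diagonal matrix D such that AD (or equivalently, DAD) is diagonally dominant")]
[cite: AhmadiMajumdar2019, §3.1 Definition 3 (dd and sdd matrices)] -/
theorem isScaledDiagDominant_iff_exists_diagonal {A : Matrix n n ℝ} :
    IsScaledDiagDominant A ↔
      ∃ d : n → ℝ, (∀ i, 0 < d i) ∧ IsDiagDominant (diagonal d * A * diagonal d) := by
  have key : ∀ d : n → ℝ, (∀ i, 0 < d i) → ∀ i,
      (∑ j ∈ univ.erase i, |(diagonal d * A * diagonal d) i j| ≤ (diagonal d * A * diagonal d) i i ↔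
        ∑ j ∈ univ.erase i, |A i j| * d j ≤ A i i * d i) := by
    intro d hd i
    simp_rw [diagonal_mul_mul_diagonal_apply, abs_mul, abs_of_pos (hd _)]
    rw [show ∑ j ∈ univ.erase i, d i * |A i j| * d j = d i * ∑ j ∈ univ.erase i, |A i j| * d j by
      rw [mul_sum]; exact sum_congr rfl fun j _ => by ring]
    rw [show d i * A i i * d i = d i * (A i i * d i) by ring]
    exact ⟨fun h => le_of_mul_le_mul_left h (hd i), fun h => mul_le_mul_of_nonneg_left h (hd i).le⟩
  constructor
  · rintro ⟨d, hd, h⟩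
    exact ⟨d, hd, fun i => (key d hd i).2 (h i)⟩
  · rintro ⟨d, hd, h⟩
    exact ⟨d, hd, fun i => (key d hd i).1 (h i)⟩

/-! ### Proposition 2: dd ⇒ factor width two -/

/-- The sign used to write `a_ij (e_i + e_j)(e_i + e_j)ᵀ` (`a_ij ≥ 0`) and
`(−a_ij)(e_i − e_j)(e_i − e_j)ᵀ` (`a_ij < 0`) uniformly as `|a_ij| (e_i + σ e_j)(e_i + σ e_j)ᵀ`. -/
@[folklore] private def sgn (x : ℝ) : ℝ := if 0 ≤ x then 1 else -1

/-- `σ² = 1`. -/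
@[folklore] private theorem sgn_mul_sgn (x : ℝ) : sgn x * sgn x = 1 := by
  unfold sgn; split_ifs <;> norm_num

/-- `|x| σ(x) = x`. -/
@[folklore] private theorem abs_mul_sgn (x : ℝ) : |x| * sgn x = x := by
  unfold sgn
  split_ifs with h
  · rw [mul_one, abs_of_nonneg h]
  · rw [abs_of_neg (lt_of_not_ge h)]; ring

/-- Kronecker delta as a real number (plumbing for the dyad bookkeeping). -/
@[folklore] private def dlt (a i : n) : ℝ := if a = i then 1 else 0

omit [Fintype n] in
/-- `δ_aa = 1`. -/
@[folklore] private theorem dlt_self (a : n) : dlt a a = 1 := if_pos rfl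

omit [Fintype n] in
/-- `δ_ai = 0` for `a ≠ i`. -/
@[folklore] private theorem dlt_of_ne {a i : n} (h : a ≠ i) : dlt a i = 0 := if_neg h

/-- **Boman–Chen–Parekh–Toledo, Proposition 2** (Barker–Carlson). A symmetric diagonally dominant
matrix with non-negative diagonal has factor width at most two:
`A = Σ_i (a_ii − Σ_{j≠i}|a_ij|) e_i e_iᵀ + Σ_{i≠j} (|a_ij|/2) (e_i + sgn(a_ij) e_j)(e_i + sgn(a_ij) e_j)ᵀ`
(the printed sum over unordered pairs `{i, j}`, written over ordered pairs with weight `|a_ij|/2`).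
[cite: BomanEtAl2005, Proposition 2] [cite: AhmadiMajumdar2019, §3.1 Lemma 1 (Barker and Carlson, extreme rays of DD_n), ⇒] -/
theorem IsDiagDominant.hasFactorWidthTwo {A : Matrix n n ℝ} (hA : A.IsSymm)
    (h : IsDiagDominant A) : HasFactorWidthTwo A := by
  classical
  -- weights and vectors of the dyads, indexed by ordered pairs `(i, j)` and by single indices `i`;
  -- the factor `1 - dlt i j` kills the (meaningless) diagonal pairs
  let c : (n × n) ⊕ n → ℝ := Sum.elim (fun p => |A p.1 p.2| / 2 * (1 - dlt p.1 p.2))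
    (fun i => A i i - ∑ j ∈ univ.erase i, |A i j|)
  let v : (n × n) ⊕ n → n → ℝ := Sum.elim (fun p a => dlt a p.1 + sgn (A p.1 p.2) * dlt a p.2)
    (fun i a => dlt a i)
  refine HasFactorWidthTwo.of_sum_dyads c v ?_ ?_ ?_
  · rintro (⟨i, j⟩ | i)
    · simp only [c, Sum.elim_inl, dlt]
      split_ifs
      · simp
      · simp only [sub_zero, mul_one]; positivity
    · simpa only [c, Sum.elim_inr, sub_nonneg] using h i
  · rintro (⟨i, j⟩ | i)
    · refine le_trans (card_le_card fun a ha => ?_) (card_le_two (a := i) (b := j))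
      simp only [mem_filter, mem_univ, true_and, v, Sum.elim_inl, dlt] at ha
      rw [mem_insert, mem_singleton]
      by_contra hne
      rw [not_or] at hne
      exact ha (by rw [if_neg hne.1, if_neg hne.2]; ring)
    · have hsub : (univ.filter fun a => v (Sum.inr i) a ≠ 0) ⊆ {i} := fun a ha => by
        simp only [mem_filter, mem_univ, true_and, v, Sum.elim_inr, dlt] at ha
        rw [mem_singleton]
        by_contra hne
        exact ha (if_neg hne)
      exact (card_le_card hsub).trans (by simp)
  · intro a b
    -- expand the products of deltas into nested `if`s
    have e1 : ∀ i j : n, c (Sum.inl (i, j)) * (v (Sum.inl (i, j)) a * v (Sum.inl (i, j)) b)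
        = (if a = i then (if b = i then |A i j| / 2 * (1 - dlt i j) else 0) else 0)
        + ((if a = i then (if b = j then |A i j| / 2 * (1 - dlt i j) * sgn (A i j) else 0) else 0)
        + ((if b = i then (if a = j then |A i j| / 2 * (1 - dlt i j) * sgn (A i j) else 0) else 0)
        + (if a = j then (if b = j then |A i j| / 2 * (1 - dlt i j) * (sgn (A i j) * sgn (A i j))
            else 0) else 0))) := by
      intro i j
      simp only [c, v, Sum.elim_inl, dlt]
      split_ifs <;> ring
    have e2 : ∀ i : n, c (Sum.inr i) * (v (Sum.inr i) a * v (Sum.inr i) b)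
        = if a = i then (if b = i then A i i - ∑ j ∈ univ.erase i, |A i j| else 0) else 0 := by
      intro i
      simp only [c, v, Sum.elim_inr, dlt]
      split_ifs <;> ring
    rw [Fintype.sum_sum_type, Fintype.sum_prod_type]
    simp only [e1, e2]
    simp only [sum_add_distrib, sum_ite_irrel, sum_const_zero, sum_ite_eq, mem_univ, if_true,
      sgn_mul_sgn, mul_one]
    -- row sums: `Σ_j (|a_bj|/2)(1 - δ_bj) = (Σ_j |a_bj|)/2 - |a_bb|/2`, and the same by columns
    have hR : ∑ j ∈ univ.erase a, |A a j| = ∑ j, |A a j| - |A a a| := sum_erase_eq_sub (mem_univ a)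
    have h1 : ∑ j, |A a j| / 2 * (1 - dlt a j) = (∑ j, |A a j|) / 2 - |A a a| / 2 := by
      have e3 : ∀ j, |A a j| / 2 * (1 - dlt a j) = |A a j| / 2 - (if a = j then |A a j| / 2 else 0) := by
        intro j; unfold dlt; split_ifs <;> ring
      simp_rw [e3, sum_sub_distrib, sum_ite_eq, mem_univ, if_true, sum_div]
    have h2 : ∑ i, |A i a| / 2 * (1 - dlt i a) = (∑ j, |A a j|) / 2 - |A a a| / 2 := by
      have e4 : ∀ i, |A i a| / 2 * (1 - dlt i a) = |A a i| / 2 - (if a = i then |A a i| / 2 else 0) := by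
        intro i
        rw [hA.apply a i]
        unfold dlt
        by_cases hia : i = a
        · rw [if_pos hia, if_pos hia.symm]; ring
        · rw [if_neg hia, if_neg (Ne.symm hia)]; ring
      simp_rw [e4, sum_sub_distrib, sum_ite_eq, mem_univ, if_true, sum_div]
    by_cases hba : b = a
    · simp only [hba, if_true, dlt_self, sub_self, mul_zero, zero_mul]
      linarith [h1, h2, hR]
    · simp only [if_neg hba, zero_add, add_zero, dlt_of_ne hba, dlt_of_ne (Ne.symm hba), sub_zero,
        mul_one]
      rw [hA.apply a b]
      linarith [abs_mul_sgn (A a b)]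

/-! ### Quadratic forms of Z-matrices; the comparison matrix of a width-two factorization -/

omit [DecidableEq n] in
/-- For a symmetric Z-matrix `C` and a positive semidefinite `B ≤ C` (entrywise), `C` is positive
semidefinite: `xᵀ C x ≥ |x|ᵀ C |x| ≥ |x|ᵀ B |x| ≥ 0` (private helper for Theorem 9 (⇒)). -/
@[folklore] private theorem IsZMatrix.posSemidef_of_posSemidef_le {B C : Matrix n n ℝ} (hC : C.IsSymm)
    (hZ : IsZMatrix C) (hB : B.PosSemidef) (hle : ∀ i j, B i j ≤ C i j) : C.PosSemidef := by
  refine PosSemidef.of_dotProduct_mulVec_nonneg (isHermitian_iff_isSymm.2 hC) fun x => ?_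
  have h0 : 0 ≤ (fun i => |x i|) ⬝ᵥ (B *ᵥ fun i => |x i|) := by
    simpa using hB.dotProduct_mulVec_nonneg (fun i => |x i|)
  have h1 : (fun i => |x i|) ⬝ᵥ (B *ᵥ fun i => |x i|) ≤ (fun i => |x i|) ⬝ᵥ (C *ᵥ fun i => |x i|) := by
    rw [dotProduct_mulVec_eq_sum_sum, dotProduct_mulVec_eq_sum_sum]
    exact sum_le_sum fun i _ => sum_le_sum fun j _ =>
      mul_le_mul_of_nonneg_left (mul_le_mul_of_nonneg_right (hle i j) (abs_nonneg _)) (abs_nonneg _)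
  have h2 : (fun i => |x i|) ⬝ᵥ (C *ᵥ fun i => |x i|) ≤ x ⬝ᵥ (C *ᵥ x) := by
    rw [dotProduct_mulVec_eq_sum_sum, dotProduct_mulVec_eq_sum_sum]
    refine sum_le_sum fun i _ => sum_le_sum fun j _ => ?_
    rcases eq_or_ne i j with rfl | hij
    · rw [show |x i| * (C i i * |x i|) = C i i * (|x i| * |x i|) by ring, abs_mul_abs_self]
      exact le_of_eq (by ring)
    · have hx : x i * x j ≤ |x i| * |x j| := by rw [← abs_mul]; exact le_abs_self _
      have h3 := mul_le_mul_of_nonpos_left hx (hZ i j hij)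
      linarith
  rw [star_trivial]
  linarith

/-- The width-two Z-matrix attached to a column `v`: `2·diag(v ∘ v) − |v| |v|ᵀ`. -/
@[folklore] private def colZ (v : n → ℝ) : Matrix n n ℝ :=
  Matrix.of fun a b => 2 * (v a * v b) * dlt a b - |v a| * |v b|

omit [Fintype n] in
/-- Diagonal entries of `colZ v`: `v_a²`. -/
@[folklore] private theorem colZ_apply_same (v : n → ℝ) (a : n) : colZ v a a = v a * v a := by
  simp only [colZ, of_apply, dlt_self, mul_one]
  rw [abs_mul_abs_self]; ring

omit [Fintype n] in
/-- Off-diagonal entries of `colZ v`: `−|v_a| |v_b|`. -/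
@[folklore] private theorem colZ_apply_of_ne (v : n → ℝ) {a b : n} (h : a ≠ b) :
    colZ v a b = -(|v a| * |v b|) := by
  simp only [colZ, of_apply, dlt_of_ne h, mul_zero, zero_sub]

omit [Fintype n] in
/-- `colZ v` is symmetric. -/
@[folklore] private theorem isSymm_colZ (v : n → ℝ) : (colZ v).IsSymm :=
  Matrix.IsSymm.ext fun a b => by
    rcases eq_or_ne a b with rfl | h
    · rfl
    · rw [colZ_apply_of_ne v h, colZ_apply_of_ne v h.symm]; ring

/-- `2·diag(v ∘ v) − |v| |v|ᵀ ⪰ 0` when `v` has at most two non-zero entries: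
`xᵀ(…)x = 2 Σ (v_a x_a)² − (Σ |v_a| x_a)² ≥ 0` by Cauchy–Schwarz on the support. -/
@[folklore] private theorem posSemidef_colZ (v : n → ℝ)
    (hv : (univ.filter fun i => v i ≠ 0).card ≤ 2) : (colZ v).PosSemidef := by
  refine PosSemidef.of_dotProduct_mulVec_nonneg (isHermitian_iff_isSymm.2 (isSymm_colZ v))
    fun x => ?_
  rw [star_trivial, dotProduct_mulVec_eq_sum_sum]
  have key : ∑ a, ∑ b, x a * (colZ v a b * x b)
      = 2 * ∑ a, (v a * x a) ^ 2 - (∑ a, |v a| * x a) ^ 2 := by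
    have e : ∀ a b, x a * (colZ v a b * x b)
        = (if a = b then 2 * (v a * x a * (v b * x b)) else 0) - |v a| * x a * (|v b| * x b) := by
      intro a b
      simp only [colZ, of_apply, dlt]
      split_ifs <;> ring
    simp only [e, sum_sub_distrib, sum_ite_eq, mem_univ, if_true]
    congr 1
    · rw [mul_sum]
      exact sum_congr rfl fun a _ => by ring
    · rw [sq, sum_mul_sum]
  rw [key]
  set S := univ.filter fun i => v i ≠ 0 with hS
  have hsum : ∑ a, |v a| * x a = ∑ a ∈ S, |v a| * x a := by
    rw [hS, sum_filter_of_ne]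
    intro a _ hne hv0
    exact hne (by rw [hv0, abs_zero, zero_mul])
  have hcs : (∑ a ∈ S, |v a| * x a) ^ 2 ≤ S.card * ∑ a ∈ S, (|v a| * x a) ^ 2 :=
    sq_sum_le_card_mul_sum_sq
  have hcard : (S.card : ℝ) ≤ 2 := by exact_mod_cast hv
  have h2 : (S.card : ℝ) * ∑ a ∈ S, (|v a| * x a) ^ 2 ≤ 2 * ∑ a ∈ S, (|v a| * x a) ^ 2 :=
    mul_le_mul_of_nonneg_right hcard (sum_nonneg fun a _ => sq_nonneg _)
  have h3 : ∑ a ∈ S, (|v a| * x a) ^ 2 ≤ ∑ a, (v a * x a) ^ 2 :=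
    calc ∑ a ∈ S, (|v a| * x a) ^ 2 = ∑ a ∈ S, (v a * x a) ^ 2 :=
          sum_congr rfl fun a _ => by rw [mul_pow, mul_pow, sq_abs]
      _ ≤ ∑ a, (v a * x a) ^ 2 := sum_le_univ_sum_of_nonneg fun a => sq_nonneg _
  rw [hsum]
  linarith

omit [Fintype n] in
/-- The comparison matrix of a symmetric matrix is symmetric ("Since `A`'s comparison matrix is
symmetric …", proof of Theorem 16). [cite: BomanEtAl2005, proof of Theorem 16 (p. 11)]
[cite: BermanPlemmons1994, Ch. 6, (2.8) Definitions] -/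
theorem isSymm_comparisonMatrix {A : Matrix n n ℝ} (hA : A.IsSymm) :
    (comparisonMatrix A).IsSymm :=
  Matrix.IsSymm.ext fun i j => by
    rcases eq_or_ne i j with rfl | hij
    · rfl
    · rw [comparisonMatrix_apply_of_ne A hij, comparisonMatrix_apply_of_ne A hij.symm, hA.apply i j]

/-- **Boman–Chen–Parekh–Toledo, Theorem 9 (⇒)** / Theorem 16: a matrix of factor width at most two
is an `H₊`-matrix, i.e. its comparison matrix `𝓜(A) = 2 D_A − |A|` is positive semidefinite.  (For
`A = Σ_t v_t v_tᵀ`, `𝓜(A) ≥ Σ_t (2·diag(v_t ∘ v_t) − |v_t| |v_t|ᵀ) ⪰ 0` entrywise with equal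
diagonals, and `𝓜(A)` is a Z-matrix.) [cite: BomanEtAl2005, Theorem 9 (⇒) and Theorem 16] -/
theorem HasFactorWidthTwo.posSemidef_comparisonMatrix {A : Matrix n n ℝ} (h : HasFactorWidthTwo A) :
    (comparisonMatrix A).PosSemidef := by
  have hAs := h.isSymm
  obtain ⟨k, v, hv, hAv⟩ := h.exists_dyads
  have hB : (∑ t, colZ (v t)).PosSemidef :=
    posSemidef_sum univ fun t _ => posSemidef_colZ (v t) (hv t)
  refine IsZMatrix.posSemidef_of_posSemidef_le (isSymm_comparisonMatrix hAs)
    (isZMatrix_comparisonMatrix A) hB fun i j => ?_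
  rw [Matrix.sum_apply]
  rcases eq_or_ne i j with rfl | hij
  · simp only [colZ_apply_same, comparisonMatrix_apply_same, Real.norm_eq_abs]
    rw [hAv i i]
    exact le_abs_self _
  · simp only [colZ_apply_of_ne _ hij, comparisonMatrix_apply_of_ne A hij, Real.norm_eq_abs,
      sum_neg_distrib, neg_le_neg_iff]
    rw [hAv i j]
    calc |∑ t, v t i * v t j| ≤ ∑ t, |v t i * v t j| := abs_sum_le_sum_abs _ _
      _ = ∑ t, |v t i| * |v t j| := sum_congr rfl fun t _ => abs_mul _ _

/-! ### Theorem 8: generalized diagonal dominance ⇔ symmetric `H₊` -/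

/-- **Theorem 8 (⇐ direction of the printed proof; Lemma 18 / supersolution argument).** A symmetric
sdd matrix has positive semidefinite comparison matrix: `y > 0` with `𝓜(A) y ≥ 0` is a positive
supersolution of the symmetric Z-matrix `𝓜(A)`. [cite: BomanEtAl2005, Theorem 8 and Lemma 18]
[cite: BermanPlemmons1994, Ch. 6, Exercise 4.14 and Exercise 4.15] -/
theorem IsScaledDiagDominant.posSemidef_comparisonMatrix {A : Matrix n n ℝ} (hA : A.IsSymm)
    (h : IsScaledDiagDominant A) : (comparisonMatrix A).PosSemidef := by
  have hd := h.diag_nonneg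
  obtain ⟨y, hy, h⟩ := h
  have hsup : ∀ i, 0 * y i ≤ (comparisonMatrix A *ᵥ y) i := fun i => by
    rw [zero_mul, comparisonMatrix_mulVec_apply, sub_nonneg]
    simp only [Real.norm_eq_abs]
    rw [abs_of_nonneg (hd i)]
    exact h i
  simpa using IsZMatrix.posSemidef_sub_smul_one_of_supersolution (isSymm_comparisonMatrix hA)
    (isZMatrix_comparisonMatrix A) y hy 0 hsup

/-- **Theorem 8 (⇒ direction; via Lemma 20).** If `𝓜(A)` is positive semidefinite and `A` has
non-negative diagonal then `A` is sdd: Lemma 20 gives `y > 0` with `𝓜(A) y ≥ 0`.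
[cite: BomanEtAl2005, Theorem 8 (proof in the Appendix, via Lemma 20)] -/
theorem isScaledDiagDominant_of_posSemidef_comparisonMatrix {A : Matrix n n ℝ}
    (hd : ∀ i, 0 ≤ A i i) (h : (comparisonMatrix A).PosSemidef) : IsScaledDiagDominant A := by
  obtain ⟨y, hy, hMy⟩ := exists_pos_mulVec_nonneg_of_posSemidef h
  refine ⟨y, hy, fun i => ?_⟩
  have h1 := hMy i
  rw [comparisonMatrix_mulVec_apply, sub_nonneg] at h1
  simp only [Real.norm_eq_abs] at h1
  rwa [abs_of_nonneg (hd i)] at h1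

/-- **Boman–Chen–Parekh–Toledo, Theorem 8** (for the class `H₊`): a symmetric matrix with
non-negative diagonal is generalized (weakly) diagonally dominant iff it is an H-matrix, i.e. iff
`𝓜(A)` is positive semidefinite. [cite: BomanEtAl2005, Theorem 8] -/
theorem isScaledDiagDominant_iff_posSemidef_comparisonMatrix {A : Matrix n n ℝ} (hA : A.IsSymm)
    (hd : ∀ i, 0 ≤ A i i) : IsScaledDiagDominant A ↔ (comparisonMatrix A).PosSemidef :=
  ⟨fun h => h.posSemidef_comparisonMatrix hA,
    fun h => isScaledDiagDominant_of_posSemidef_comparisonMatrix hd h⟩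

/-! ### Theorem 9: factor width two ⇔ sdd ⇔ symmetric `H₊` -/

/-- **Theorem 9 (⇐).** A symmetric sdd matrix has factor width at most two: if `DAD` is dd then
`DAD = V Vᵀ` by Proposition 2 and `A = (D⁻¹V)(D⁻¹V)ᵀ`. [cite: BomanEtAl2005, Theorem 9 (⇐)]
[cite: AhmadiMajumdar2019, §3.1 Theorem 4 (sdd ⇔ factor width at most 2)] -/
theorem IsScaledDiagDominant.hasFactorWidthTwo {A : Matrix n n ℝ} (hA : A.IsSymm)
    (h : IsScaledDiagDominant A) : HasFactorWidthTwo A := by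
  obtain ⟨d, hd, hdd⟩ := isScaledDiagDominant_iff_exists_diagonal.1 h
  have hBs : (diagonal d * A * diagonal d).IsSymm := by
    unfold Matrix.IsSymm
    rw [transpose_mul, transpose_mul, diagonal_transpose, hA.eq, Matrix.mul_assoc]
  obtain ⟨k, v, hv, hBv⟩ := (hdd.hasFactorWidthTwo hBs).exists_dyads
  refine HasFactorWidthTwo.of_sum_dyads (fun _ => (1 : ℝ)) (fun t i => v t i / d i)
    (fun _ => zero_le_one) ?_ ?_
  · intro t
    refine le_trans (card_le_card fun i hi => ?_) (hv t)
    simp only [mem_filter, mem_univ, true_and] at hi ⊢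
    intro h0
    exact hi (by rw [h0, zero_div])
  · intro i j
    have hB := hBv i j
    rw [diagonal_mul_mul_diagonal_apply] at hB
    simp_rw [one_mul, div_mul_div_comm, ← sum_div, ← hB]
    rw [eq_div_iff (mul_ne_zero (hd i).ne' (hd j).ne')]
    ring

/-- **Boman–Chen–Parekh–Toledo, Theorem 9** with Theorem 8: for a symmetric matrix, factor width
at most two ⇔ scaled diagonal dominance. [cite: BomanEtAl2005, Theorem 9]
[cite: AhmadiMajumdar2019, §3.1 Theorem 4 (sdd ⇔ factor width at most 2, "see theorems 8 and 9 by Boman et al.")] -/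
theorem hasFactorWidthTwo_iff_isScaledDiagDominant {A : Matrix n n ℝ} (hA : A.IsSymm) :
    HasFactorWidthTwo A ↔ IsScaledDiagDominant A :=
  ⟨fun h => isScaledDiagDominant_of_posSemidef_comparisonMatrix
      (fun _ => h.posSemidef.diag_nonneg) h.posSemidef_comparisonMatrix,
    fun h => h.hasFactorWidthTwo hA⟩

/-- **Boman–Chen–Parekh–Toledo, Theorem 9** as printed: "A matrix has factor width at most two if
and only if it is a symmetric `H₊`-matrix", with `H₊` unfolded (Lemma 5, Definition 6, proof of
Theorem 16): symmetric, non-negative diagonal, and `𝓜(A) = 2 D_A − |A|` positive semidefinite.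
[cite: BomanEtAl2005, Theorem 9 (with Lemma 5, Definition 6, proof of Theorem 16)] -/
theorem hasFactorWidthTwo_iff_posSemidef_comparisonMatrix {A : Matrix n n ℝ} :
    HasFactorWidthTwo A ↔ A.IsSymm ∧ (∀ i, 0 ≤ A i i) ∧ (comparisonMatrix A).PosSemidef :=
  ⟨fun h => ⟨h.isSymm, fun _ => h.posSemidef.diag_nonneg, h.posSemidef_comparisonMatrix⟩,
    fun h => (isScaledDiagDominant_of_posSemidef_comparisonMatrix h.2.1 h.2.2).hasFactorWidthTwo h.1⟩

/-- `SDD_n ⊆ P_n`: a symmetric sdd matrix is positive semidefinite.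
[cite: AhmadiMajumdar2019, §3.1 after Definition 3 ("DD_n ⊆ SDD_n ⊆ P_n")] [cite: BomanEtAl2005, Theorem 9] -/
theorem IsScaledDiagDominant.posSemidef {A : Matrix n n ℝ} (hA : A.IsSymm)
    (h : IsScaledDiagDominant A) : A.PosSemidef :=
  (h.hasFactorWidthTwo hA).posSemidef

/-- `DD_n ⊆ P_n`: a symmetric dd matrix with non-negative diagonal is positive semidefinite
(Gershgorin; here through factor width two).  The `offRowSum` spelling over `ℝ` is
`Literature.Analysis.ValidatedNumerics.IntervalGershgorin.posSemidef_of_diagDominant`.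
[cite: AhmadiMajumdar2019, §3.1 after Definition 3 ("DD_n ⊆ SDD_n ⊆ P_n")] [cite: BomanEtAl2005, Proposition 2] -/
theorem IsDiagDominant.posSemidef {A : Matrix n n ℝ} (hA : A.IsSymm) (h : IsDiagDominant A) :
    A.PosSemidef :=
  (h.hasFactorWidthTwo hA).posSemidef

/-! ### Ahmadi–Majumdar's Lemma: sdd = sums of psd matrices supported on pairs of indices -/

/-- A positive semidefinite matrix supported on rows/columns `i, j` is sdd (witness `y_i = |m_ij|`,
`y_j = m_ii` when `m_ij ≠ 0`, using the `2 × 2` minor `m_ij² ≤ m_ii m_jj`; `y = 𝟙` otherwise).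
[cite: AhmadiMajumdar2019, §3.1 Lemma 2 (sdd ⇔ Q = Σ_{i<j} M^{ij}, M^{ij} ⪰ 0 supported on {i,j}), ⇐] -/
theorem isScaledDiagDominant_of_posSemidef_pair {M : Matrix n n ℝ} (hM : M.PosSemidef) (i j : n)
    (hsupp : ∀ a b, M a b ≠ 0 → (a = i ∨ a = j) ∧ (b = i ∨ b = j)) :
    IsScaledDiagDominant M := by
  have hsymm : M.IsSymm := isHermitian_iff_isSymm.1 hM.1
  have hdiag : ∀ a, 0 ≤ M a a := fun a => hM.diag_nonneg
  have hminor : M i j * M i j ≤ M i i * M j j := by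
    rcases eq_or_ne i j with rfl | hij
    · exact le_rfl
    · have hdet := (hM.submatrix ![i, j]).det_nonneg
      rw [det_fin_two] at hdet
      simp only [submatrix_apply, Matrix.cons_val_zero, Matrix.cons_val_one] at hdet
      rw [hsymm.apply i j] at hdet
      linarith
  by_cases hoff : ∀ a b, a ≠ b → M a b = 0
  · refine ⟨fun _ => 1, fun _ => one_pos, fun a => ?_⟩
    rw [sum_eq_zero fun b hb => by rw [hoff a b (ne_of_mem_erase hb).symm, abs_zero, zero_mul],
      mul_one]
    exact hdiag a
  · obtain ⟨a, b, hab, hMab⟩ : ∃ a b, a ≠ b ∧ M a b ≠ 0 := by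
      by_contra hne
      exact hoff fun a b hab => by_contra fun hM0 => hne ⟨a, b, hab, hM0⟩
    have hq : M i j ≠ 0 := by
      obtain ⟨ha, hb⟩ := hsupp a b hMab
      rcases ha with ha | ha <;> rcases hb with hb | hb <;> rw [ha, hb] at hMab
      · exact absurd (ha.trans hb.symm) hab
      · exact hMab
      · rwa [hsymm.apply i j] at hMab
      · exact absurd (ha.trans hb.symm) hab
    have hij : i ≠ j := by
      rintro rfl
      obtain ⟨ha, hb⟩ := hsupp a b hMab
      simp only [or_self] at ha hb
      exact hab (ha.trans hb.symm)
    have hii : 0 < M i i := by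
      rcases (hdiag i).eq_or_lt with h0 | h0
      · exfalso
        rw [← h0, zero_mul] at hminor
        exact hq (mul_self_eq_zero.1 (le_antisymm hminor (mul_self_nonneg _)))
      · exact h0
    -- zero pattern of the rows
    have hrow : ∀ a b, b ≠ i → b ≠ j → M a b = 0 := fun a b hbi hbj => by
      by_contra hne
      rcases (hsupp a b hne).2 with hb | hb
      · exact hbi hb
      · exact hbj hb
    refine ⟨fun a => if a = i then |M i j| else M i i, fun a => ?_, fun a => ?_⟩
    · dsimp only
      split_ifs
      · exact abs_pos.2 hq
      · exact hii
    · dsimp only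
      by_cases hai : a = i
      · rw [hai, sum_eq_single_of_mem j (mem_erase.2 ⟨hij.symm, mem_univ j⟩) fun b hb hbj => by
          rw [hrow i b (ne_of_mem_erase hb) hbj, abs_zero, zero_mul]]
        rw [if_neg hij.symm, if_pos rfl]
        exact le_of_eq (mul_comm _ _)
      by_cases haj : a = j
      · rw [haj, sum_eq_single_of_mem i (mem_erase.2 ⟨hij, mem_univ i⟩) fun b hb hbi => by
          rw [hrow j b hbi (ne_of_mem_erase hb), abs_zero, zero_mul]]
        rw [if_pos rfl, if_neg hij.symm, hsymm.apply i j, abs_mul_abs_self]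
        linarith
      · have hzero : ∀ b, M a b = 0 := fun b => by
          by_contra hne
          rcases (hsupp a b hne).1 with ha | ha
          · exact hai ha
          · exact haj ha
        rw [sum_eq_zero fun b _ => by rw [hzero b, abs_zero, zero_mul], hzero a, zero_mul]

/-- A positive semidefinite matrix supported on a pair of indices has factor width at most two.
[cite: AhmadiMajumdar2019, §3.1 Lemma 2 with Theorem 4 (a psd M^{ij} is sdd, hence of factor width 2)] -/
theorem hasFactorWidthTwo_of_posSemidef_pair {M : Matrix n n ℝ} (hM : M.PosSemidef) (i j : n)
    (hsupp : ∀ a b, M a b ≠ 0 → (a = i ∨ a = j) ∧ (b = i ∨ b = j)) : HasFactorWidthTwo M :=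
  (isScaledDiagDominant_of_posSemidef_pair hM i j hsupp).hasFactorWidthTwo
    (isHermitian_iff_isSymm.1 hM.1)

/-- **Ahmadi–Majumdar, Lemma (⇐)**: `Σ_t M_t` with each `M_t ⪰ 0` supported on rows/columns
`p_t, q_t` has factor width at most two (is sdd) — the second-order-cone description of `SDD_n`.
[cite: AhmadiMajumdar2019, §3.1 Lemma 2 (sdd ⇔ Q = Σ_{i<j} M^{ij}, M^{ij} ⪰ 0 supported on {i,j}), ⇐] -/
theorem HasFactorWidthTwo.of_sum_blocks {ι : Type*} (s : Finset ι) (M : ι → Matrix n n ℝ)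
    (p q : ι → n) (hpsd : ∀ t ∈ s, (M t).PosSemidef)
    (hsupp : ∀ t ∈ s, ∀ a b, M t a b ≠ 0 → (a = p t ∨ a = q t) ∧ (b = p t ∨ b = q t)) :
    HasFactorWidthTwo (∑ t ∈ s, M t) :=
  HasFactorWidthTwo.sum s fun t ht =>
    hasFactorWidthTwo_of_posSemidef_pair (hpsd t ht) (p t) (q t) (hsupp t ht)

/-- **Ahmadi–Majumdar, Lemma (⇒)**: a matrix of factor width at most two is a finite sum of
positive semidefinite matrices each supported on a pair of indices (the dyads `v_t v_tᵀ`).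
[cite: AhmadiMajumdar2019, §3.1 Lemma 2 (sdd ⇔ Q = Σ_{i<j} M^{ij}, M^{ij} ⪰ 0 supported on {i,j}), ⇒] -/
theorem HasFactorWidthTwo.exists_sum_blocks {A : Matrix n n ℝ} (h : HasFactorWidthTwo A) :
    ∃ (k : ℕ) (M : Fin k → Matrix n n ℝ) (p q : Fin k → n), (∀ t, (M t).PosSemidef) ∧
      (∀ t a b, M t a b ≠ 0 → (a = p t ∨ a = q t) ∧ (b = p t ∨ b = q t)) ∧ A = ∑ t, M t := by
  classical
  rcases isEmpty_or_nonempty n with hn | hn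
  · exact ⟨0, Fin.elim0, Fin.elim0, Fin.elim0, fun t => t.elim0, fun t => t.elim0,
      Matrix.ext fun i _ => isEmptyElim i⟩
  obtain ⟨k, v, hv, hAv⟩ := h.exists_dyads
  -- a pair of indices covering the support of each column
  have hpair : ∀ t, ∃ pq : n × n, ∀ a, v t a ≠ 0 → a = pq.1 ∨ a = pq.2 := by
    intro t
    have hmem : ∀ a, v t a ≠ 0 → a ∈ univ.filter fun i => v t i ≠ 0 := fun a ha => by
      simpa using ha
    have hc : (univ.filter fun i => v t i ≠ 0).card = 0 ∨ (univ.filter fun i => v t i ≠ 0).card = 1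
        ∨ (univ.filter fun i => v t i ≠ 0).card = 2 := by
      have := hv t
      omega
    rcases hc with h0 | h1 | h2
    · refine ⟨(hn.some, hn.some), fun a ha => ?_⟩
      have hm := hmem a ha
      rw [card_eq_zero.1 h0] at hm
      simp at hm
    · obtain ⟨a₀, hS⟩ := card_eq_one.1 h1
      refine ⟨(a₀, a₀), fun a ha => Or.inl ?_⟩
      have hm := hmem a ha
      rw [hS] at hm
      exact mem_singleton.1 hm
    · obtain ⟨x, y, -, hS⟩ := card_eq_two.1 h2
      refine ⟨(x, y), fun a ha => ?_⟩
      have hm := hmem a ha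
      rw [hS, mem_insert, mem_singleton] at hm
      exact hm
  choose pq hpq using hpair
  refine ⟨k, fun t => vecMulVec (v t) (v t), fun t => (pq t).1, fun t => (pq t).2, fun t => ?_,
    fun t a b hab => ?_, ?_⟩
  · simpa using posSemidef_vecMulVec_self_star (v t)
  · dsimp only at hab ⊢
    rw [vecMulVec_apply] at hab
    exact ⟨hpq t a (left_ne_zero_of_mul hab), hpq t b (right_ne_zero_of_mul hab)⟩
  · ext i j
    rw [Matrix.sum_apply, hAv i j]
    simp [vecMulVec_apply]

/-! ### Strictness from `n = 3` on (Proposition 3 with `k = 3`) -/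

/-- The all-ones `3 × 3` matrix `𝟙 𝟙ᵀ` is positive semidefinite …
[cite: BomanEtAl2005, Proposition 3 (k = 3: "v vᵀ has factor width k")] -/
theorem posSemidef_ones_fin_three : (Matrix.of fun (_ _ : Fin 3) => (1 : ℝ)).PosSemidef := by
  have h1 : (Matrix.of fun (_ _ : Fin 3) => (1 : ℝ)) = vecMulVec 1 (star 1) := by
    ext i j
    simp [vecMulVec_apply]
  rw [h1]
  exact posSemidef_vecMulVec_self_star 1

/-- … but does not have factor width two: its comparison matrix `2I − J₃` has `𝟙ᵀ(2I − J₃)𝟙 = −3`.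
So `FW(2) = SDD_3 ⊊ PSD_3` ("these containments are strict for `n > 2`").
[cite: BomanEtAl2005, Proposition 3 (k = 3)] [cite: AhmadiMajumdar2019, §3.1 after Definition 3 ("These containments are strict for n > 2")] -/
theorem not_hasFactorWidthTwo_ones_fin_three :
    ¬ HasFactorWidthTwo (Matrix.of fun (_ _ : Fin 3) => (1 : ℝ)) := by
  intro h
  have h1 := h.posSemidef_comparisonMatrix.dotProduct_mulVec_nonneg (fun _ => 1)
  have h2 : star (fun _ : Fin 3 => (1 : ℝ)) ⬝ᵥ
      (comparisonMatrix (Matrix.of fun (_ _ : Fin 3) => (1 : ℝ)) *ᵥ fun _ => 1) = -3 := by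
    simp [comparisonMatrix, dotProduct, mulVec, Fin.sum_univ_three]
    norm_num
  linarith

end DiagonalDominance

end Literature.LinearAlgebra.Matrix

end
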